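import Literature.Probability.RandomPlanarGeometry.LoewnerTraceFunctional
import Literature.Probability.RandomPlanarGeometry.SLEImageLocalisationTimes
import Literature.Probability.RandomPlanarGeometry.SLEBoundaryHitting
import Mathlib.Probability.BrownianMotion.Basic
import HarnessLib

/-!
# First hits of closed sets as measurable path functionals; exhaustion events

Topic `Probability/RandomPlanarGeometry`; theorems only. Measure-theoretic lemmas for the
probabilistic assembly of the locality of chordal SLE₆ with respect to a bounded hull
(`SLESixHullLocalityAlive.lean`, crux `stmt-CriticalPhenomena-0698`, stub `stub_isLocal`):

* `firstHit_le_coe_iff`, `isClosed_setOf_firstHit_le`, `measurable_untopD_firstHit` — the first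
  hitting time of a closed set is a measurable (indeed lower semicontinuous) functional of a
  continuous path `ℝ≥0 → ℂ` (projection along the compact factor `[0, t]`);
* `measurable_stopClass_traceOf_firstHit` — the class of the trace of a driving path stopped at
  the first hit of a closed set is a measurable functional of the path;
* `measurableSet_setOf_lt_of_isStoppingTime` — `{σ < T}` is measurable for stopping times of the
  (right-continuous) Brownian filtration;
* `measure_prod_preimage_fst`, `tendsto_measure_compl_of_ae_eventually_mem` — two elementary
  measure lemmas (cylinders over the first factor; `μ (E m)ᶜ → 0` when a.e. point is eventually
  in `E m`).
-/

noncomputable section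

open Set Filter Topology Function MeasureTheory ProbabilityTheory
open scoped NNReal unitInterval ENNReal

namespace Literature.Probability.RandomPlanarGeometry

open Literature.Probability.Process Loewner
open scoped PathBorel

/-! ### The first hitting time of a closed set is a measurable functional of a continuous path -/

section FirstHitMeasurable

variable {S : Set ℂ}

/-- For a continuous path and a closed set, `firstHit γ S ≤ t` iff the path meets `S` by time `t`.
[folklore] -/
theorem firstHit_le_coe_iff (hS : IsClosed S) (γ : C(ℝ≥0, ℂ)) (t : ℝ≥0) :
    firstHit γ S ≤ t ↔ ∃ s ≤ t, γ s ∈ S := by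
  constructor
  · intro h
    have hne : firstHit γ S ≠ ⊤ := ne_top_of_le_ne_top WithTop.coe_ne_top h
    obtain ⟨s, hs, hγs⟩ := exists_firstHit_eq_coe γ.continuous hS hne
    exact ⟨s, by rw [hs] at h; exact_mod_cast h, hγs⟩
  · rintro ⟨s, hs, hγs⟩
    exact (firstHit_le hγs).trans (by exact_mod_cast hs)

/-- **`{γ | firstHit γ S ≤ t}` is closed** in `C(ℝ≥0, ℂ)` for closed `S`: it is the projection along
the compact factor `[0, t]` of the closed set `{(γ, s) | γ s ∈ S}`. [folklore] -/
theorem isClosed_setOf_firstHit_le (hS : IsClosed S) (t : ℝ≥0) :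
    IsClosed {γ : C(ℝ≥0, ℂ) | firstHit γ S ≤ t} := by
  have heq : {γ : C(ℝ≥0, ℂ) | firstHit γ S ≤ t} =
      Prod.fst '' {p : C(ℝ≥0, ℂ) × Icc (0 : ℝ≥0) t | p.1 p.2 ∈ S} := by
    ext γ
    simp only [mem_setOf_eq, mem_image, Prod.exists, exists_and_right, exists_eq_right,
      firstHit_le_coe_iff hS, Subtype.exists, mem_Icc]
    constructor
    · rintro ⟨s, hs, hγs⟩; exact ⟨s, ⟨bot_le, hs⟩, hγs⟩
    · rintro ⟨s, ⟨-, hs⟩, hγs⟩; exact ⟨s, hs, hγs⟩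
  rw [heq]
  refine (isClosedMap_fst_of_compactSpace) _ (hS.preimage ?_)
  exact continuous_eval.comp (continuous_fst.prodMk (continuous_subtype_val.comp continuous_snd))

/-- `{γ | firstHit γ S = ⊤}` is measurable (never hit by any integer time). [folklore] -/
theorem measurableSet_setOf_firstHit_eq_top (hS : IsClosed S) :
    MeasurableSet {γ : C(ℝ≥0, ℂ) | firstHit γ S = ⊤} := by
  have heq : {γ : C(ℝ≥0, ℂ) | firstHit γ S = ⊤} = ⋂ n : ℕ, {γ : C(ℝ≥0, ℂ) | firstHit γ S ≤ (n : ℝ≥0)}ᶜ := by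
    ext γ
    simp only [mem_setOf_eq, mem_iInter, mem_compl_iff, not_le]
    constructor
    · intro h n; rw [h]; exact WithTop.coe_lt_top _
    · intro h
      by_contra hne
      obtain ⟨s, hs⟩ := WithTop.ne_top_iff_exists.1 hne
      obtain ⟨n, hn⟩ := exists_nat_ge s
      exact absurd (h n) (by rw [← hs]; exact not_lt.2 (by exact_mod_cast hn))
  rw [heq]
  exact MeasurableSet.iInter fun n ↦ (isClosed_setOf_firstHit_le hS _).measurableSet.compl

/-- **The (defaulted) first hitting time of a closed set is a measurable functional of the
continuous path.** [folklore] -/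
theorem measurable_untopD_firstHit (hS : IsClosed S) :
    Measurable fun γ : C(ℝ≥0, ℂ) ↦ (firstHit γ S).untopD 0 := by
  refine measurable_of_Iic fun t ↦ ?_
  have heq : (fun γ : C(ℝ≥0, ℂ) ↦ (firstHit γ S).untopD 0) ⁻¹' Iic t =
      {γ : C(ℝ≥0, ℂ) | firstHit γ S ≤ t} ∪ {γ : C(ℝ≥0, ℂ) | firstHit γ S = ⊤} := by
    ext γ
    simp only [mem_preimage, mem_Iic, mem_union, mem_setOf_eq]
    rcases eq_or_ne (firstHit γ S) ⊤ with h | h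
    · simp [h]
    · obtain ⟨s, hs⟩ := WithTop.ne_top_iff_exists.1 h
      rw [← hs, WithTop.untopD_coe]
      constructor
      · intro hst; exact Or.inl (WithTop.coe_le_coe.2 hst)
      · rintro (hst | hst)
        · exact WithTop.coe_le_coe.1 hst
        · exact absurd hst WithTop.coe_ne_top
  rw [heq]
  exact (isClosed_setOf_firstHit_le hS t).measurableSet.union (measurableSet_setOf_firstHit_eq_top hS)

/-- The class of the trace of a path stopped at the first hit of a closed set is a measurable
functional of the path. [folklore] -/
theorem measurable_stopClass_traceOf_firstHit (hS : IsClosed S) :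
    Measurable fun η : C(ℝ≥0, ℝ) ↦ stopClass (traceOf η) ((firstHit (traceOf η) S).untopD 0) :=
  Measurable.stopClass measurable_traceOf ((measurable_untopD_firstHit hS).comp measurable_traceOf)

end FirstHitMeasurable

/-! ### Measurability of the exhaustion events -/

section Events

/-- **`{σ < T}` is measurable** for a stopping time `σ` of the right-continuous Brownian filtration
and a stopping time `T` of the Brownian filtration (both valued in `WithTop ℝ≥0`): it is the countable
union over nonnegative rationals `q` of `{σ < q} ∩ {q ≤ T}`. [folklore] -/
theorem measurableSet_setOf_lt_of_isStoppingTime {τ₁ T : (ℝ≥0 → ℝ) → WithTop ℝ≥0}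
    (hσ : IsStoppingTime brownianFiltration.rightCont τ₁) (hT : IsStoppingTime brownianFiltration T) :
    MeasurableSet {ω | τ₁ ω < T ω} := by
  have heq : {ω | τ₁ ω < T ω} = ⋃ q : ℚ, ({ω | τ₁ ω < ((q : ℝ).toNNReal : ℝ≥0)} ∩
      {ω | (((q : ℝ).toNNReal : ℝ≥0) : WithTop ℝ≥0) ≤ T ω}) := by
    ext ω
    simp only [mem_setOf_eq, mem_iUnion, mem_inter_iff]
    constructor
    · intro h
      have hσne : τ₁ ω ≠ ⊤ := ne_top_of_lt h
      obtain ⟨u, hu⟩ := WithTop.ne_top_iff_exists.1 hσne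
      rcases eq_or_ne (T ω) ⊤ with hT' | hT'
      · obtain ⟨q, hq⟩ := exists_rat_gt (u : ℝ)
        refine ⟨q, ?_, by rw [hT']; exact le_top⟩
        rw [← hu]
        exact WithTop.coe_lt_coe.2 (by
          rw [← NNReal.coe_lt_coe, Real.coe_toNNReal _ (u.coe_nonneg.trans hq.le)]; exact hq)
      · obtain ⟨v, hv⟩ := WithTop.ne_top_iff_exists.1 hT'
        rw [← hu, ← hv] at h
        have huv : (u : ℝ) < v := NNReal.coe_lt_coe.2 (WithTop.coe_lt_coe.1 h)
        obtain ⟨q, huq, hqv⟩ := exists_rat_btwn huv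
        have hq0 : 0 ≤ (q : ℝ) := u.coe_nonneg.trans huq.le
        refine ⟨q, ?_, ?_⟩
        · rw [← hu]
          exact WithTop.coe_lt_coe.2 (by rw [← NNReal.coe_lt_coe, Real.coe_toNNReal _ hq0]; exact huq)
        · rw [← hv]
          exact WithTop.coe_le_coe.2 (by rw [← NNReal.coe_le_coe, Real.coe_toNNReal _ hq0]; exact hqv.le)
    · rintro ⟨q, h1, h2⟩
      exact lt_of_lt_of_le h1 h2
  rw [heq]
  refine MeasurableSet.iUnion fun q ↦ MeasurableSet.inter ?_ ?_
  · exact brownianFiltration.rightCont.le _ _ (hσ.measurableSet_lt _)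
  · have h := brownianFiltration.le _ _ (hT.measurableSet_lt ((q : ℝ).toNNReal))
    have heq' : {ω | (((q : ℝ).toNNReal : ℝ≥0) : WithTop ℝ≥0) ≤ T ω} =
        {ω | T ω < (((q : ℝ).toNNReal : ℝ≥0) : WithTop ℝ≥0)}ᶜ := by
      ext ω; simp only [mem_setOf_eq, mem_compl_iff, not_lt]
    rw [heq']
    exact h.compl

end Events

/-! ### Two measure lemmas -/

section MeasureLemmas

/-- A cylinder over the first factor has the measure of its base. [folklore] -/
theorem measure_prod_preimage_fst {Ω : Type*} [MeasurableSpace Ω] (P Q : Measure Ω)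
    [IsProbabilityMeasure Q] [SFinite Q] [SFinite P] (B : Set Ω) :
    (P.prod Q) {z : Ω × Ω | z.1 ∈ B} = P B := by
  have : {z : Ω × Ω | z.1 ∈ B} = B ×ˢ (univ : Set Ω) := by
    ext z; simp
  rw [this, Measure.prod_prod, measure_univ, mul_one]

/-- If almost every point is eventually in `E m`, then `μ (E m)ᶜ → 0` (measurable `E m`, finite
measure). [folklore] -/
theorem tendsto_measure_compl_of_ae_eventually_mem {Ω : Type*} [MeasurableSpace Ω] {μ : Measure Ω}
    [IsProbabilityMeasure μ] {E : ℕ → Set Ω} (hE : ∀ m, MeasurableSet (E m))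
    (h : ∀ᵐ z ∂μ, ∀ᶠ m in atTop, z ∈ E m) : Tendsto (fun m ↦ μ (E m)ᶜ) atTop (𝓝 0) := by
  set F : ℕ → Set Ω := fun m ↦ ⋂ k, ⋂ (_ : m ≤ k), E k with hF
  have hFmeas : ∀ m, MeasurableSet (F m) := fun m ↦
    MeasurableSet.iInter fun k ↦ MeasurableSet.iInter fun _ ↦ hE k
  have hFmono : Monotone F := fun m m' hmm' ↦ by
    intro z hz
    simp only [hF, mem_iInter] at hz ⊢
    exact fun k hk ↦ hz k (hmm'.trans hk)
  have hFE : ∀ m, F m ⊆ E m := fun m z hz ↦ by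
    simp only [hF, mem_iInter] at hz; exact hz m le_rfl
  -- `⋃ F m` has full measure
  have hfull : μ (⋃ m, F m) = 1 := by
    have hae : ∀ᵐ z ∂μ, z ∈ ⋃ m, F m := by
      filter_upwards [h] with z hz
      obtain ⟨m, hm⟩ := hz.exists_forall_of_atTop
      simp only [mem_iUnion, hF, mem_iInter]
      exact ⟨m, fun k hk ↦ hm k hk⟩
    have h0 : μ (⋃ m, F m)ᶜ = 0 := ae_iff.1 hae
    exact (prob_compl_eq_zero_iff (MeasurableSet.iUnion hFmeas)).1 h0
  have hlim : Tendsto (fun m ↦ μ (F m)) atTop (𝓝 1) := by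
    rw [← hfull]; exact tendsto_measure_iUnion_atTop hFmono
  have hcompl : Tendsto (fun m ↦ μ (F m)ᶜ) atTop (𝓝 0) := by
    have h1 : ∀ m, μ (F m)ᶜ = 1 - μ (F m) := fun m ↦ prob_compl_eq_one_sub (hFmeas m)
    simp only [h1]
    have := ENNReal.Tendsto.sub (tendsto_const_nhds (x := (1 : ℝ≥0∞))) hlim (Or.inl ENNReal.one_ne_top)
    rwa [tsub_self] at this
  exact tendsto_of_tendsto_of_tendsto_of_le_of_le tendsto_const_nhds hcompl (fun _ ↦ bot_le)
    fun m ↦ measure_mono (compl_subset_compl.2 (hFE m))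

end MeasureLemmas

end Literature.Probability.RandomPlanarGeometry

end
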